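import Summits.Parity.GeneralizedHardyLittlewood.Theses.EntropyRate

/-!
# `ChowlaFixed` (stmt-Parity-17879): the shift condition `1 ≤ h` is load-bearing

Negative lemma for the node `EntropyRate.ChowlaFixed` (route EntropyRate; refuter crux-attack at
birth).  `ChowlaFixed` reads `∀ h ≥ 1, Σ_{n=1}^{N} λ(n) λ(n+h) = o(N)` with `λ` = Mathlib's
`ArithmeticFunction.liouville`.  At the excluded shift `h = 0` the sum is `N` exactly
(`λ(n)² = 1` for `n ≥ 1`), so the same family with `1 ≤ h` dropped is false: any proof of
`ChowlaFixed` must use `1 ≤ h`, and the side condition as filed is the right one.  Every instance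
`h ≥ 1` is the classical binary Chowla conjecture at natural density (open: Tao 2016 is
logarithmically averaged, Tao–Teräväinen 2019 holds at almost all scales), so no instance of the
item itself is decided here. [folklore]
-/

namespace Summit.Parity.GeneralizedHardyLittlewood.Theorems.ChowlaFixed.Negative

open Filter Asymptotics

/-- `λ(n)² = 1` for `n ≠ 0`. -/
theorem liouville_mul_self {n : ℕ} (hn : n ≠ 0) :
    (ArithmeticFunction.liouville n : ℤ) * ArithmeticFunction.liouville n = 1 := by
  rw [ArithmeticFunction.liouville_apply hn, ← pow_add, ← two_mul, pow_mul]
  simp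

/-- On the diagonal `h = 0` the Chowla sum of `ChowlaFixed` is exactly `N`. -/
theorem chowlaSum_zero (N : ℕ) :
    ∑ n ∈ Finset.Icc 1 N,
      (((ArithmeticFunction.liouville n * ArithmeticFunction.liouville (n + 0) : ℤ)) : ℝ) = N := by
  have hterm : ∀ n ∈ Finset.Icc 1 N,
      (((ArithmeticFunction.liouville n * ArithmeticFunction.liouville (n + 0) : ℤ)) : ℝ) = 1 := by
    intro n hn
    have hn1 : n ≠ 0 := by
      have := (Finset.mem_Icc.mp hn).1
      omega
    rw [Nat.add_zero, liouville_mul_self hn1]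
    simp
  rw [Finset.sum_congr rfl hterm]
  simp

/-- The `h = 0` instance of the body of `ChowlaFixed` fails: `Σ_{n ≤ N} λ(n)² = N` is not `o(N)`. -/
theorem chowlaFixed_body_false_at_zero :
    ¬ (fun N : ℕ => ∑ n ∈ Finset.Icc 1 N,
        (((ArithmeticFunction.liouville n * ArithmeticFunction.liouville (n + 0) : ℤ)) : ℝ))
      =o[Filter.atTop] fun N : ℕ => (N : ℝ) := by
  intro h
  have h1 : (fun N : ℕ => (N : ℝ)) =o[atTop] fun N : ℕ => (N : ℝ) :=
    h.congr' (Eventually.of_forall fun N => chowlaSum_zero N) EventuallyEq.rfl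
  refine isLittleO_irrefl' (f' := fun N : ℕ => (N : ℝ)) (l := atTop) ?_ h1
  refine Eventually.frequently ?_
  filter_upwards [eventually_ge_atTop 1] with N hN
  simp only [Real.norm_natCast, ne_eq, Nat.cast_eq_zero]
  omega

/-- LOAD-BEARING: `EntropyRate.ChowlaFixed` with its side condition `1 ≤ h` dropped (verbatim the
same body, quantified over all `h : ℕ`) is false — witness the diagonal `h = 0`. -/
theorem chowlaFixed_false_without_shiftPos :
    ¬ (∀ h : ℕ, (fun N : ℕ => ∑ n ∈ Finset.Icc 1 N,
        (((ArithmeticFunction.liouville n * ArithmeticFunction.liouville (n + h) : ℤ)) : ℝ))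
      =o[Filter.atTop] fun N : ℕ => (N : ℝ)) :=
  fun h => chowlaFixed_body_false_at_zero (h 0)

end Summit.Parity.GeneralizedHardyLittlewood.Theorems.ChowlaFixed.Negative
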